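import Mathlib.Analysis.SpecialFunctions.Pow.Asymptotics
import Mathlib.Analysis.Complex.Basic
import Summits.MatrixMultiplication.Statement
import Summits.MatrixMultiplication.MatrixMultiplication.Theorems.AsymptoticSpectrumFlattening

/-!
# MatrixMultiplication / AsymptoticSpectrum — `ω ≥ 2` and `BddBelow`

Route `MatrixMultiplication/AsymptoticSpectrum`, item `stmt-MatrixMultiplication-0586` (rank 6, the
lower frame shared by all positive routes): every admissible exponent is `≥ 2` (from the
flattening bound `n² ≤ R(⟨n,n,n⟩)`, `Flattening.lean`, and `n^{2-β} → ∞` for `β < 2`), hence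
`admissibleExponents K` is bounded below and `2 ≤ ω(K)` for every field `K`; in particular over
`ℂ` (Bläser 2013, §5–§6).
-/

noncomputable section

open Filter Asymptotics

namespace Literature.CplxAlg

universe u

variable (K : Type u) [Field K]

/-- Every admissible exponent is at least `2` (Bläser 2013, §6: `R(⟨n,n,n⟩) ≥ n²`).
[cite: Blaser2013, §6] -/
theorem two_le_of_mem_admissibleExponents {β : ℝ} (hβ : β ∈ Literature.Computability.AlgebraicComplexity.admissibleExponents K) : 2 ≤ β := by
  by_contra hlt
  rw [not_le] at hlt
  obtain ⟨C, hC⟩ := hβ.bound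
  have hev : ∀ᶠ n : ℕ in atTop, (n : ℝ) ^ (2 - β) ≤ C := by
    filter_upwards [hC, eventually_ge_atTop 1] with n hn hn1
    have hpos : (0 : ℝ) < n := by exact_mod_cast hn1
    rw [Real.norm_of_nonneg (Nat.cast_nonneg _),
      Real.norm_of_nonneg (Real.rpow_nonneg hpos.le _)] at hn
    have hsq : (n : ℝ) ^ (2 : ℝ) ≤ C * (n : ℝ) ^ β := by
      calc (n : ℝ) ^ (2 : ℝ) = ((n ^ 2 : ℕ) : ℝ) := by rw [Real.rpow_two]; push_cast; ring
        _ ≤ (Literature.Computability.AlgebraicComplexity.tensorRank (Literature.Computability.AlgebraicComplexity.matMulTensor K n n n) : ℝ) := by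
          exact_mod_cast sq_le_tensorRank_matMulTensor K n
        _ ≤ C * (n : ℝ) ^ β := hn
    rw [Real.rpow_sub hpos, div_le_iff₀ (Real.rpow_pos_of_pos hpos _)]
    exact hsq
  have ht : Tendsto (fun n : ℕ => (n : ℝ) ^ (2 - β)) atTop atTop :=
    (tendsto_rpow_atTop (by linarith)).comp tendsto_natCast_atTop_atTop
  obtain ⟨n, hn1, hn2⟩ := (hev.and (ht.eventually_gt_atTop C)).exists
  exact absurd hn1 (not_le.mpr hn2)

/-- The admissible exponents over a field are bounded below (by `2`). [cite: Blaser2013, §6] -/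
theorem bddBelow_admissibleExponents : BddBelow (Literature.Computability.AlgebraicComplexity.admissibleExponents K) :=
  ⟨2, fun _ hβ => two_le_of_mem_admissibleExponents K hβ⟩

/-- `2 ≤ ω(K)` for every field `K` (Bläser 2013, §6). [cite: Blaser2013, §6] -/
theorem two_le_omega : 2 ≤ Literature.Computability.AlgebraicComplexity.omega K :=
  le_csInf (Literature.Computability.AlgebraicComplexity.admissibleExponents_nonempty K) fun _ hβ => two_le_of_mem_admissibleExponents K hβ

/-- `2 ≤ ω(K) ≤ 3` for every field `K`. [cite: Blaser2013, §5–§6] -/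
theorem omega_mem_Icc : Literature.Computability.AlgebraicComplexity.omega K ∈ Set.Icc (2 : ℝ) 3 :=
  ⟨two_le_omega K, Literature.Computability.AlgebraicComplexity.omega_le_three K (bddBelow_admissibleExponents K)⟩

/-- Settles `stmt-MatrixMultiplication-0586`, exact signature: the lower frame over `ℂ`.
[cite: Blaser2013, §6] -/
theorem omega_ge_two :
    BddBelow (Literature.Computability.AlgebraicComplexity.admissibleExponents ℂ) ∧ 2 ≤ Literature.Computability.AlgebraicComplexity.omega ℂ :=
  ⟨bddBelow_admissibleExponents ℂ, two_le_omega ℂ⟩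

end Literature.CplxAlg
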